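import Literature.Computability.AlgebraicComplexity.BorderRankMatMulThreeVerdictRun1
import Literature.Computability.AlgebraicComplexity.BorderRankMatMulThreeVerdictRun2
import Literature.Computability.AlgebraicComplexity.BorderRankMatMulThreeVerdictRun3
import Literature.Computability.AlgebraicComplexity.BorderRankMatMulThreeVerdictRun4
import Literature.Computability.AlgebraicComplexity.BorderRankMatMulThreeVerdictRun5
import Literature.Computability.AlgebraicComplexity.BorderRankMatMulThreeVerdictRun6
import Literature.Computability.AlgebraicComplexity.BorderRankMatMulThreeVerdictRun7
import Literature.Computability.AlgebraicComplexity.BorderRankMatMulThreeVerdictRun8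
import Literature.Computability.AlgebraicComplexity.BorderRankMatMulThreeVerdictRun9
import Literature.Computability.AlgebraicComplexity.BorderRankMatMulThreeVerdictRun10
import Literature.Computability.AlgebraicComplexity.BorderRankMatMulThreeVerdictRun11
import Literature.Computability.AlgebraicComplexity.BorderRankMatMulThreeVerdictRun12
import HarnessLib

/-!
# Borel-fixed `(110)`-candidates of `⟨3,3,3⟩`: the kernel verdict on every killed profile

Topic `Literature/Computability/AlgebraicComplexity`. Assembly of the twelve kernel runs
`BorderRankMatMulThreeVerdictRun1..12.lean`:

* `MatMul3.killedProfs_verdict` — **the verdict `Ker.verdictH` holds for every entry of the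
  killed table `MatMul3.killedProfs`** (with its hints), i.e. each of the `272` killed profiles has
  at most one free block and fails, for every variant of the free diagonal, the hinted
  `(210)`/`(120)` test with certified dimension `≤ 15`.

## References

* A. Conner, A. Harper, J. M. Landsberg, *New lower bounds for matrix multiplication and `det₃`*,
  Forum Math. Pi 11 (2023) e17, arXiv:1911.07981 — §6. [ConnerHarperLandsberg2023]
-/

namespace Literature.Computability.AlgebraicComplexity

namespace BorderApolarity

namespace MatMul3

/-- The verdict holds at every index `i < 272` of the killed table. [cite: ConnerHarperLandsberg2023, §6] -/
theorem verdictRun (i : ℕ) (hi : i < 272) :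
    Ker.verdictH (killedProfs.getD i ([], [])).1 (killedProfs.getD i ([], [])).2 = true := by
  by_cases g1 : i < 40
  · exact verdictRun1 i (by omega) g1
  by_cases g2 : i < 76
  · exact verdictRun2 i (by omega) g2
  by_cases g3 : i < 113
  · exact verdictRun3 i (by omega) g3
  by_cases g4 : i < 149
  · exact verdictRun4 i (by omega) g4
  by_cases g5 : i < 185
  · exact verdictRun5 i (by omega) g5
  by_cases g6 : i < 220
  · exact verdictRun6 i (by omega) g6
  by_cases g7 : i < 232
  · exact verdictRun7 i (by omega) g7
  by_cases g8 : i < 237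
  · exact verdictRun8 i (by omega) g8
  by_cases g9 : i < 241
  · exact verdictRun9 i (by omega) g9
  by_cases g10 : i < 246
  · exact verdictRun10 i (by omega) g10
  by_cases g11 : i < 250
  · exact verdictRun11 i (by omega) g11
  exact verdictRun12 i (by omega) hi

/-- **The kernel verdict holds for every killed profile.** [cite: ConnerHarperLandsberg2023, §6] -/
theorem killedProfs_verdict : ∀ ph ∈ killedProfs, Ker.verdictH ph.1 ph.2 = true := by
  intro ph hph
  obtain ⟨i, hi, rfl⟩ := List.mem_iff_getElem.1 hph
  have hlen : killedProfs.length = 272 := by decide +kernel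
  have h := verdictRun i (by omega)
  rwa [List.getD_eq_getElem?_getD, List.getElem?_eq_getElem hi, Option.getD_some] at h

end MatMul3

end BorderApolarity

end Literature.Computability.AlgebraicComplexity
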